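import Literature.AlgebraicGeometry.Motives.CartierDivisorCocycleIntegral
import HarnessLib

/-!
# Sections of `(ψ ≫ φ)^*𝒪_X(D)` as sections of `ψ^*𝒪_Y(φ^*D)`

For a morphism `φ : Y → X` of integral schemes and a Cartier divisor `D` on `X`, the pulled-back
divisor `φ^*D` on `Y` is available in two situations in the concrete model of
`Motives/CartierDivisor`: `D.pullback φ` for `φ` dominant, and `D.pullbackAvoiding φ hD` when the
support of `D` misses `φ(η_Y)` (`Motives/CartierDivisorClassPullback`). In both cases the charts
of `φ^*D` are the `φ⁻¹U_i` and its transition functions are the pulled-back ones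
(`transFun_pullback`, `transFun_pullbackAvoiding`: `g^{φ^*D}_{ij} = φ^*(g_ij)` as sections on the
integral scheme `Y`), so that for ANY further morphism `ψ : X'' → Y` (typically from a non-reduced
scheme, an infinitesimal thickening of a fibre) the chart-form sections of `Motives/CartierDivisorCocycle`
correspond literally:

* `SectionAlong.toPullback` / `ofPullback` — `D.SectionAlong (ψ ≫ φ) ≃ (D.pullback φ).SectionAlong ψ`
  (same coordinates), preserving nowhere-vanishing sections (`Trivialization.toPullback`,
  `trivialAlong_comp_iff_pullback`);
* `Trivialization.toPullbackAvoiding` — a trivialisation of `(ψ ≫ φ)^*𝒪_X(D)` gives one of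
  `ψ^*𝒪_Y(φ^*D)` for `φ^*D = D.pullbackAvoiding φ hD` (restriction to the charts through `φ(η_Y)`),
  `TrivialAlong.pullbackAvoiding`.

This is the bookkeeping `(ψ ≫ φ)^* = ψ^* ∘ φ^*` on line bundles (Görtz–Wedhorn I, Rem. 11.16 and
(11.16), p. 392), fully proved; no named facts.

## References

* U. Görtz, T. Wedhorn, *Algebraic Geometry I: Schemes*, 2nd ed. (2020): Prop. 11.15, Rem. 11.16
  (pp. 368–369), (11.16) and Def. 11.49 (p. 392). [GortzWedhorn2020]
-/

universe u

open CategoryTheory AlgebraicGeometry TopologicalSpace Opposite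

noncomputable section

namespace Literature.AlgebraicGeometry.Motives

namespace CartierDivisor

open RatFn

variable {X Y X'' : Scheme.{u}} [IsIntegral X] [IsIntegral Y] (D : CartierDivisor X) (φ : Y ⟶ X)

omit [IsIntegral X] [IsIntegral Y] in
/-- Pulling back sections along a composite, on opens: `(ψ ≫ φ)^* = ψ^* ∘ φ^*`. [folklore] -/
theorem appLE_appLE (ψ : X'' ⟶ Y) {U : X.Opens} {V : Y.Opens} {W : X''.Opens} (e₁ : V ≤ φ ⁻¹ᵁ U)
    (e₂ : W ≤ ψ ⁻¹ᵁ V) (e₃ : W ≤ (ψ ≫ φ) ⁻¹ᵁ U) (t : Γ(X, U)) :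
    ψ.appLE V W e₂ (φ.appLE U V e₁ t) = (ψ ≫ φ).appLE U W e₃ t := by
  rw [← CommRingCat.comp_apply, Scheme.Hom.appLE_comp_appLE]

/-! ### Dominant `φ`: `D.pullback φ` -/

section Dominant

variable [IsDominant φ]

/-- **The transition functions of `φ^*D` are `φ^*(g_ij)`** (as sections on the integral `Y`).
[folklore] -/
theorem transFun_pullback (i j : D.ι) :
    (D.pullback φ).transFun i j =
      φ.appLE (D.U i ⊓ D.U j) (φ ⁻¹ᵁ D.U i ⊓ φ ⁻¹ᵁ D.U j) (D.preimage_inf_le φ i j)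
        (D.transFun i j) := by
  refine section_ext fun hV => ?_
  have hV' : genericPoint Y ∈ φ ⁻¹ᵁ D.U i ⊓ φ ⁻¹ᵁ D.U j := hV
  rw [ofSection_transFun]
  change _ = ofSection hV' (φ.appLE _ _ (D.preimage_inf_le φ i j) (D.transFun i j))
  rw [ofSection_appLE, ofSection_transFun, pullbackFn_eq_functionFieldMap, map_div₀]
  rfl

variable {D φ}

/-- **A section of `(ψ ≫ φ)^*𝒪_X(D)` is a section of `ψ^*𝒪_Y(φ^*D)`** (same coordinates).
[folklore] -/
def SectionAlong.toPullback {ψ : X'' ⟶ Y} (s : D.SectionAlong (ψ ≫ φ)) :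
    (D.pullback φ).SectionAlong ψ where
  σ i := s.σ i
  cocycle i j := by
    refine (s.cocycle i j).trans ?_
    congr 1
    exact ((appLE_appLE φ ψ (D.preimage_inf_le φ i j) ((D.pullback φ).preimage_inf_le ψ i j)
      (D.preimage_inf_le (ψ ≫ φ) i j) (D.transFun i j)).symm.trans
        (congrArg _ (transFun_pullback D φ i j).symm))

/-- Conversely. [folklore] -/
def SectionAlong.ofPullback {ψ : X'' ⟶ Y} (s : (D.pullback φ).SectionAlong ψ) :
    D.SectionAlong (ψ ≫ φ) where
  σ i := s.σ i
  cocycle i j := by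
    refine (s.cocycle i j).trans ?_
    congr 1
    exact ((congrArg _ (transFun_pullback D φ i j)).trans
      (appLE_appLE φ ψ (D.preimage_inf_le φ i j) ((D.pullback φ).preimage_inf_le ψ i j)
        (D.preimage_inf_le (ψ ≫ φ) i j) (D.transFun i j)))

/-- The coordinates of `toPullback`. [folklore] -/
@[simp] theorem SectionAlong.toPullback_σ {ψ : X'' ⟶ Y} (s : D.SectionAlong (ψ ≫ φ)) (i : D.ι) :
    (s.toPullback : (D.pullback φ).SectionAlong ψ).σ i = s.σ i := rfl

/-- The coordinates of `ofPullback`. [folklore] -/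
@[simp] theorem SectionAlong.ofPullback_σ {ψ : X'' ⟶ Y} (s : (D.pullback φ).SectionAlong ψ) (i : D.ι) :
    (SectionAlong.ofPullback s : D.SectionAlong (ψ ≫ φ)).σ i = s.σ i := rfl

/-- A trivialisation of `(ψ ≫ φ)^*𝒪_X(D)` is a trivialisation of `ψ^*𝒪_Y(φ^*D)`. [folklore] -/
def Trivialization.toPullback {ψ : X'' ⟶ Y} (τ : D.Trivialization (ψ ≫ φ)) :
    (D.pullback φ).Trivialization ψ :=
  { τ.toSectionAlong.toPullback with isUnit := fun i => τ.isUnit i }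

/-- Conversely. [folklore] -/
def Trivialization.ofPullback {ψ : X'' ⟶ Y} (τ : (D.pullback φ).Trivialization ψ) :
    D.Trivialization (ψ ≫ φ) :=
  { SectionAlong.ofPullback τ.toSectionAlong with isUnit := fun i => τ.isUnit i }

variable (D φ) in
/-- **`(ψ ≫ φ)^*𝒪_X(D)` is trivial iff `ψ^*𝒪_Y(φ^*D)` is**, `φ` dominant. [folklore] -/
theorem trivialAlong_comp_iff_pullback (ψ : X'' ⟶ Y) :
    D.TrivialAlong (ψ ≫ φ) ↔ (D.pullback φ).TrivialAlong ψ :=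
  ⟨fun ⟨τ⟩ => ⟨τ.toPullback⟩, fun ⟨τ⟩ => ⟨Trivialization.ofPullback τ⟩⟩

end Dominant

/-! ### `D` avoiding `φ(η_Y)`: `D.pullbackAvoiding φ hD` -/

section Avoiding

variable (hD : D.Avoids (φ (genericPoint Y)))

/-- **The transition functions of `φ^*D = D.pullbackAvoiding φ hD` are `φ^*(g_ij)`** on the
charts through `φ(η_Y)`. [folklore] -/
theorem transFun_pullbackAvoiding (i j : (D.pullbackAvoiding φ hD).ι) :
    (D.pullbackAvoiding φ hD).transFun i j =
      φ.appLE (D.U i.1 ⊓ D.U j.1) (φ ⁻¹ᵁ D.U i.1 ⊓ φ ⁻¹ᵁ D.U j.1) (D.preimage_inf_le φ i.1 j.1)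
        (D.transFun i.1 j.1) := by
  refine section_ext fun hV => ?_
  have hV' : genericPoint Y ∈ φ ⁻¹ᵁ D.U i.1 ⊓ φ ⁻¹ᵁ D.U j.1 := hV
  rw [ofSection_transFun]
  change _ = ofSection hV' (φ.appLE _ _ (D.preimage_inf_le φ i.1 j.1) (D.transFun i.1 j.1))
  rw [ofSection_appLE, ofSection_transFun, pullbackAvoiding_f, pullbackAvoiding_f,
    pullbackFn_div φ (hD i.1 i.2).isRegularAt (hD j.1 j.2)]

variable {D φ hD}

/-- **A trivialisation of `(ψ ≫ φ)^*𝒪_X(D)` restricts to a trivialisation of `ψ^*𝒪_Y(φ^*D)`**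
for `φ^*D = D.pullbackAvoiding φ hD` (keep the coordinates on the charts through `φ(η_Y)`).
[folklore] -/
def Trivialization.toPullbackAvoiding {ψ : X'' ⟶ Y} (τ : D.Trivialization (ψ ≫ φ)) :
    (D.pullbackAvoiding φ hD).Trivialization ψ where
  σ i := τ.σ i.1
  cocycle i j := by
    refine (τ.cocycle i.1 j.1).trans ?_
    congr 1
    exact ((appLE_appLE φ ψ (D.preimage_inf_le φ i.1 j.1)
      ((D.pullbackAvoiding φ hD).preimage_inf_le ψ i j) (D.preimage_inf_le (ψ ≫ φ) i.1 j.1)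
        (D.transFun i.1 j.1)).symm.trans (congrArg _ (transFun_pullbackAvoiding D φ hD i j).symm))
  isUnit i := τ.isUnit i.1

/-- **`(ψ ≫ φ)^*𝒪_X(D)` trivial ⇒ `ψ^*𝒪_Y(φ^*D)` trivial** for `D` avoiding `φ(η_Y)`. [folklore] -/
theorem TrivialAlong.pullbackAvoiding {ψ : X'' ⟶ Y} (h : D.TrivialAlong (ψ ≫ φ)) :
    (D.pullbackAvoiding φ hD).TrivialAlong ψ := by
  obtain ⟨τ⟩ := h
  exact ⟨τ.toPullbackAvoiding⟩

end Avoiding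

end CartierDivisor

end Literature.AlgebraicGeometry.Motives

end
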